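/-
b2b-lace packet, TAIL-BOUND ANALYST gen 11 (unit `b2b-lace-tail-g11`).  (S2b)-IMPR TABLE-SIDE KIT (T7): the PER-CONE READING of the
far region `Q = {x : ‖x‖₁ ≥ 3}` of the `f₃` cells — `Q` is the `W_d`-orbit of the three upper cones of the nodes `3e₁`, `2e₁+e₂`,
`e₁+e₂+e₃` ([NoBLE17] §5.1 p. 1093; notebook node list `{{0,0,1},{1,1},{3}}`), so a `W_d`-invariant bound holds on `Q` iff it holds on
each cone; plus the per-cone suprema of the table entries `I_{p,l}` (Lemma M) and `S_{p,l}` (cone majorant) and the cone form of the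
`𝒥` rule.  `d`-generic; additive; no numeral of any dimension; everything proved.
-/
import Literature.Probability.FitznerVanDerHofstad2017.SrwIntegralIShiftNearNodes
import HarnessLib

/-!
# Per-cone reading of `Q = {‖x‖₁ ≥ 3}` for the `f₃` cell bounds

[NoBLE17] = Fitzner–van der Hofstad, *Generalized approach to the non-backtracking lace expansion*, PTRF 169 (2017)
(`FitznerVanDerHofstad2016NoBLE`); [FvdH17] = *Mean-field behavior for nearest-neighbor percolation in `d > 10`*, EJP 22 (2017)
(`FitznerVanDerHofstad2017`) with its Mathematica notebooks.

The numerical bound (3.87) on `Σ_x ‖x‖₂² p^{n-l}(H ⋆ D^{⋆l})(x)` restricted to a set `𝒴` is evaluated in [NoBLE17] §5.1 / the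
[FvdH17] notebooks (`BoundFThreeBound[n,l,{nodes}]`) as the MAXIMUM over a finite node list of the composite evaluated AT the node,
the node list for `Q = {‖x‖₁ ≥ 3}` being `{3e₁, 2e₁+e₂, e₁+e₂+e₃}`.  The justification is per-cone: every `x ∈ Q` has a
`W_d`-image whose coordinatewise absolute values dominate one of the three nodes (`exists_spAct_mem_absCone_of_three_le`), the
composite is `W_d`-invariant (`F3Bounds.boundHD75_srwTrue_spAct`), and on the upper cone `{x : |x_j| ≥ v_j ∀ j}` of a node `v` every
table entry is bounded by a per-cone supremum (`I`: Lemma M, attained at the node; `S`: the cone majorant `shift2Cone`; `𝒥`: the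
cone-table rule `srwJ_le_of_partsTables`; `T, U, K`: supplied by the numerics seats).  This file types exactly that reading:

* §1 `absCone v` and its elementary properties;
* §2 the cone cover of `Q` and the transfer of `W_d`-invariant predicates (`forall_three_le_iff_absCones`);
* §3 per-cone entry bounds: `le_on_absCone_of_absMonotone` / `srwI_le_on_absCone`, `shift2Cone`, `shift2Sum_le_shift2Cone`,
  the node read forms of `shift2Cone` at `3e₁`, `2e₁+e₂`, `e₁+e₂+e₃`, and `srwJ_le_on_absCone_of_partsTables`;
* §4 (`namespace F3Bounds`) the glue `boundHD75_srwTrue_three_le_of_absCones` (three cone bounds ⇒ the bound on all of `Q`, the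
  shape of the hypotheses `h0Q`, `h1Q` of `NobleWeightedDiagramBoundSmallX`) and `boundHD75_srwTrue_calX_le_of_nodes_of_absCones`.

No dimension, no table, no numeric value, no certificate; no statement about `d ≠` anything.
-/

noncomputable section

namespace Literature.Probability.FitznerVanDerHofstad2017

open Finset Real
open Literature.Barriers.CriticalPhenomena Literature.Probability.LatticeModels

variable {d : ℕ}

/-! ### §1  Upper cones -/

/-- The upper cone of `v`: the points whose coordinatewise absolute values dominate `v` (the hypothesis shape of
`srwJ_le_of_coneTables`). [cite: FitznerVanDerHofstad2016NoBLE, §5.1 p. 1093 (the sets `Q`, `P` and their node lists)] -/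
def absCone (v : Fin d → ℤ) : Set (Fin d → ℤ) := {x | ∀ j, v j ≤ |x j|}

/-- Membership in `absCone v`. [cite: FitznerVanDerHofstad2016NoBLE, §5.1 p. 1093] -/
theorem mem_absCone {v x : Fin d → ℤ} : x ∈ absCone v ↔ ∀ j, v j ≤ |x j| := Iff.rfl

/-- A node lies in its own cone. [cite: FitznerVanDerHofstad2016NoBLE, §5.1 p. 1093] -/
theorem self_mem_absCone (v : Fin d → ℤ) : v ∈ absCone v := fun j => le_abs_self (v j)

/-- Cones are nested contravariantly in the node. [cite: FitznerVanDerHofstad2016NoBLE, §5.1 p. 1093] -/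
theorem absCone_mono {v w : Fin d → ℤ} (h : ∀ j, v j ≤ w j) : absCone w ⊆ absCone v :=
  fun _ hx μ => (h μ).trans (hx μ)

/-- Zero-padded partitions are coordinatewise nonnegative (local copy of `vecOfParts_nonneg` of `SrwIntegralJTables`,
which is not imported here). [folklore] -/
private theorem vecOfParts_nonneg' (p : List ℕ) (j : Fin d) : 0 ≤ vecOfParts d p j := by
  unfold vecOfParts; positivity

/-- On a cone, `‖x‖₁ ≥ Σ_j v_j`. [cite: FitznerVanDerHofstad2016NoBLE, §5.1 p. 1093] -/
theorem sum_le_sum_abs_of_mem_absCone {v x : Fin d → ℤ} (hx : x ∈ absCone v) : ∑ j, v j ≤ ∑ j, |x j| :=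
  Finset.sum_le_sum fun j _ => hx j

/-- `Σ_j (3e₁)_j = 3`. [cite: FitznerVanDerHofstad2016NoBLE, §5.1 p. 1093] -/
theorem sum_vecOfParts_three (hd : 1 ≤ d) : ∑ j, vecOfParts d [3] j = 3 := by
  rw [vecOfParts_single_eq_axisVec hd, sum_axisVec (by omega)]; norm_num

/-- `Σ_j (2e₁+e₂)_j = 3`. [cite: FitznerVanDerHofstad2016NoBLE, §5.1 p. 1093] -/
theorem sum_vecOfParts_two_one (hd : 2 ≤ d) : ∑ j, vecOfParts d [2, 1] j = 3 := by
  rw [vecOfParts_pair_eq_axisVec hd]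
  simp_rw [Pi.add_apply]
  rw [Finset.sum_add_distrib, sum_axisVec (by omega), sum_axisVec (by omega)]; norm_num

/-- `Σ_j (e₁+e₂+e₃)_j = 3`. [cite: FitznerVanDerHofstad2016NoBLE, §5.1 p. 1093] -/
theorem sum_vecOfParts_one_one_one (hd : 3 ≤ d) : ∑ j, vecOfParts d [1, 1, 1] j = 3 := by
  rw [vecOfParts_triple_eq_axisVec hd]
  simp_rw [Pi.add_apply]
  rw [Finset.sum_add_distrib, Finset.sum_add_distrib, sum_axisVec (by omega), sum_axisVec (by omega),
    sum_axisVec (by omega)]; norm_num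

/-- The three node cones lie inside `Q = {‖x‖₁ ≥ 3}`: node `3e₁`. [cite: FitznerVanDerHofstad2016NoBLE, §5.1 p. 1093] -/
theorem three_le_sum_abs_of_mem_absCone_three (hd : 1 ≤ d) {x : Fin d → ℤ} (hx : x ∈ absCone (vecOfParts d [3])) :
    3 ≤ ∑ j, |x j| := by
  have h := sum_le_sum_abs_of_mem_absCone hx
  rwa [sum_vecOfParts_three hd] at h

/-- The three node cones lie inside `Q`: node `2e₁+e₂`. [cite: FitznerVanDerHofstad2016NoBLE, §5.1 p. 1093] -/
theorem three_le_sum_abs_of_mem_absCone_two_one (hd : 2 ≤ d) {x : Fin d → ℤ} (hx : x ∈ absCone (vecOfParts d [2, 1])) :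
    3 ≤ ∑ j, |x j| := by
  have h := sum_le_sum_abs_of_mem_absCone hx
  rwa [sum_vecOfParts_two_one hd] at h

/-- The three node cones lie inside `Q`: node `e₁+e₂+e₃`. [cite: FitznerVanDerHofstad2016NoBLE, §5.1 p. 1093] -/
theorem three_le_sum_abs_of_mem_absCone_one_one_one (hd : 3 ≤ d) {x : Fin d → ℤ}
    (hx : x ∈ absCone (vecOfParts d [1, 1, 1])) : 3 ≤ ∑ j, |x j| := by
  have h := sum_le_sum_abs_of_mem_absCone hx
  rwa [sum_vecOfParts_one_one_one hd] at h

/-! ### §2  The cone cover of `Q = {‖x‖₁ ≥ 3}` -/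

/-- **Sorted trichotomy on `Q`.**  A sorted non-negative `y` with `Σ_j y_j ≥ 3` dominates `3e₁`, `2e₁+e₂` or `e₁+e₂+e₃` coordinatewise
(`y₁ ≥ 3`; or `y₁ = 2`, forcing `y₂ ≥ 1`; or `y₁ = 1`, forcing `y₂ = y₃ = 1`).
[cite: FitznerVanDerHofstad2016NoBLE, §5.1 p. 1093 (node list of `Q`)] [cite: FitznerVanDerHofstad2017, §2.5, notebook Percolation.nb (`BoundFThreeBound[·,·,{{3},{1,1},{0,0,1}}]`)] -/
theorem sorted_mem_absCone_cases (hd : 3 ≤ d) {y : Fin d → ℤ} (hanti : Antitone y) (hy0 : ∀ j, 0 ≤ y j)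
    (hsum : 3 ≤ ∑ j, y j) :
    y ∈ absCone (vecOfParts d [3]) ∨ y ∈ absCone (vecOfParts d [2, 1]) ∨ y ∈ absCone (vecOfParts d [1, 1, 1]) := by
  set i₀ : Fin d := ⟨0, by omega⟩ with hi₀
  set i₁ : Fin d := ⟨1, by omega⟩ with hi₁
  set i₂ : Fin d := ⟨2, by omega⟩ with hi₂
  have hyabs : ∀ j, |y j| = y j := fun j => abs_of_nonneg (hy0 j)
  -- tails of the sorted vector
  have htail₁ : ∀ j : Fin d, j ≠ i₀ → y j ≤ y i₁ := fun j hj =>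
    hanti (show i₁ ≤ j from Fin.mk_le_of_le_val (by
      have : (j : ℕ) ≠ 0 := fun h => hj (Fin.ext (by simpa [hi₀] using h)); omega))
  have htail₂ : ∀ j : Fin d, j ≠ i₀ → j ≠ i₁ → y j ≤ y i₂ := fun j hj hj' =>
    hanti (show i₂ ≤ j from Fin.mk_le_of_le_val (by
      have h0 : (j : ℕ) ≠ 0 := fun h => hj (Fin.ext (by simpa [hi₀] using h))
      have h1 : (j : ℕ) ≠ 1 := fun h => hj' (Fin.ext (by simpa [hi₁] using h))
      omega))
  have h01 : i₁ ≠ i₀ := by simp [hi₀, hi₁, Fin.ext_iff]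
  -- Σ_j y_j = y i₀ + Σ_{j ≠ i₀} y_j = y i₀ + y i₁ + Σ_{j ≠ i₀, i₁} y_j
  have hsplit₁ : ∑ j, y j = y i₀ + ∑ j ∈ Finset.univ.erase i₀, y j :=
    (Finset.add_sum_erase _ _ (Finset.mem_univ i₀)).symm
  have hsplit₂ : ∑ j ∈ Finset.univ.erase i₀, y j = y i₁ + ∑ j ∈ (Finset.univ.erase i₀).erase i₁, y j :=
    (Finset.add_sum_erase _ _ (Finset.mem_erase.2 ⟨h01, Finset.mem_univ i₁⟩)).symm
  by_cases h3 : 3 ≤ y i₀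
  · refine Or.inl fun j => ?_
    rw [vecOfParts_single_apply, hyabs]
    split_ifs with hj
    · have : j = i₀ := Fin.ext hj
      rw [this]; exact_mod_cast h3
    · exact hy0 j
  by_cases h2 : y i₀ = 2
  · -- then `y i₁ ≥ 1`
    have h1 : 1 ≤ y i₁ := by
      by_contra hlt
      have hle : ∑ j ∈ Finset.univ.erase i₀, y j ≤ 0 :=
        Finset.sum_nonpos fun j hj => (htail₁ j (Finset.ne_of_mem_erase hj)).trans (by omega)
      omega
    refine Or.inr (Or.inl fun j => ?_)
    rw [vecOfParts_pair_apply, hyabs]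
    split_ifs with hj hj'
    · have : j = i₀ := Fin.ext hj
      rw [this]; exact_mod_cast h2.ge
    · have : j = i₁ := Fin.ext hj'
      rw [this]; exact_mod_cast h1
    · exact hy0 j
  · -- `y i₀ ≤ 1`, hence `y i₂ ≥ 1` and then `y i₀ ≥ y i₁ ≥ y i₂ ≥ 1`
    have hy₀ : y i₀ ≤ 1 := by omega
    have h1 : 1 ≤ y i₂ := by
      by_contra hlt
      have hle : ∑ j ∈ (Finset.univ.erase i₀).erase i₁, y j ≤ 0 :=
        Finset.sum_nonpos fun j hj =>
          (htail₂ j (Finset.ne_of_mem_erase (Finset.mem_of_mem_erase hj)) (Finset.ne_of_mem_erase hj)).trans (by omega)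
      have : y i₁ ≤ y i₀ := hanti (Fin.mk_le_of_le_val (by simp [hi₁]))
      omega
    have h1' : 1 ≤ y i₁ := h1.trans (hanti (Fin.mk_le_of_le_val (by simp [hi₂])))
    have h1'' : 1 ≤ y i₀ := h1'.trans (hanti (Fin.mk_le_of_le_val (by simp [hi₁])))
    refine Or.inr (Or.inr fun j => ?_)
    rw [vecOfParts_triple_apply, hyabs]
    split_ifs with hj hj' hj''
    · have : j = i₀ := Fin.ext hj
      rw [this]; exact_mod_cast h1''
    · have : j = i₁ := Fin.ext hj'
      rw [this]; exact_mod_cast h1'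
    · have : j = i₂ := Fin.ext hj''
      rw [this]; exact_mod_cast h1
    · exact hy0 j

/-- **Cone cover of `Q`.**  Every `x` with `‖x‖₁ ≥ 3` has a `W_d`-image in the upper cone of `3e₁`, of `2e₁+e₂` or of `e₁+e₂+e₃`.
[cite: FitznerVanDerHofstad2016NoBLE, §5.1 p. 1093] [cite: FitznerVanDerHofstad2017, §2.5, notebook Percolation.nb (`boundF3[2,o]`, `boundF3[3,o]`)] -/
theorem exists_spAct_mem_absCone_of_three_le (hd : 3 ≤ d) (x : Fin d → ℤ) (hx : 3 ≤ ∑ j, |x j|) :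
    ∃ τ : SgnPermPair d, spAct τ x ∈ absCone (vecOfParts d [3]) ∨ spAct τ x ∈ absCone (vecOfParts d [2, 1]) ∨
      spAct τ x ∈ absCone (vecOfParts d [1, 1, 1]) := by
  obtain ⟨τ, hanti, hy0, hsum, -⟩ := exists_spAct_sorted x
  exact ⟨τ, sorted_mem_absCone_cases hd hanti hy0 (by rw [hsum]; exact hx)⟩

/-- **Per-cone reading, `⇒`.**  A property that descends along `W_d` and holds on the three node cones holds on all of `Q`.
[cite: FitznerVanDerHofstad2016NoBLE, §5.1 p. 1093] -/
theorem forall_three_le_of_absCones (hd : 3 ≤ d) {P : (Fin d → ℤ) → Prop}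
    (hP : ∀ (τ : SgnPermPair d) (x : Fin d → ℤ), P (spAct τ x) → P x)
    (h3 : ∀ x ∈ absCone (vecOfParts d [3]), P x) (h21 : ∀ x ∈ absCone (vecOfParts d [2, 1]), P x)
    (h111 : ∀ x ∈ absCone (vecOfParts d [1, 1, 1]), P x) :
    ∀ x : Fin d → ℤ, 3 ≤ ∑ j, |x j| → P x := by
  intro x hx
  obtain ⟨τ, h⟩ := exists_spAct_mem_absCone_of_three_le hd x hx
  rcases h with h | h | h
  · exact hP τ x (h3 _ h)
  · exact hP τ x (h21 _ h)
  · exact hP τ x (h111 _ h)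

/-- **Per-cone reading, `⇔`** for a `W_d`-invariant property. [cite: FitznerVanDerHofstad2016NoBLE, §5.1 p. 1093] -/
theorem forall_three_le_iff_absCones (hd : 3 ≤ d) {P : (Fin d → ℤ) → Prop}
    (hP : ∀ (τ : SgnPermPair d) (x : Fin d → ℤ), P (spAct τ x) → P x) :
    (∀ x : Fin d → ℤ, 3 ≤ ∑ j, |x j| → P x) ↔
      (∀ x ∈ absCone (vecOfParts d [3]), P x) ∧ (∀ x ∈ absCone (vecOfParts d [2, 1]), P x) ∧
        (∀ x ∈ absCone (vecOfParts d [1, 1, 1]), P x) :=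
  ⟨fun h => ⟨fun x hx => h x (three_le_sum_abs_of_mem_absCone_three (by omega) hx),
    fun x hx => h x (three_le_sum_abs_of_mem_absCone_two_one (by omega) hx),
    fun x hx => h x (three_le_sum_abs_of_mem_absCone_one_one_one hd hx)⟩,
   fun h => forall_three_le_of_absCones hd hP h.1 h.2.1 h.2.2⟩

/-! ### §3  Per-cone suprema of the table entries -/

/-- **Lemma M on a cone**: a coordinatewise-monotone table attains its supremum over `absCone v` (`v ≥ 0`) at the node `v`.
[cite: FitznerVanDerHofstad2016NoBLE, Lemma 5.1 p. 1093] -/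
theorem le_of_absMonotone_of_mem_absCone {F : (Fin d → ℤ) → ℝ} (hF : AbsMonotone F) {v x : Fin d → ℤ}
    (hv0 : ∀ j, 0 ≤ v j) (hx : x ∈ absCone v) : F x ≤ F v :=
  hF x v fun μ => by rw [abs_of_nonneg (hv0 μ)]; exact hx μ

/-- Read form of Lemma M on a cone. [cite: FitznerVanDerHofstad2016NoBLE, Lemma 5.1 p. 1093] -/
theorem le_on_absCone_of_absMonotone {F : (Fin d → ℤ) → ℝ} (hF : AbsMonotone F) {v : Fin d → ℤ} (hv0 : ∀ j, 0 ≤ v j)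
    {B : ℝ} (hB : F v ≤ B) : ∀ x ∈ absCone v, F x ≤ B :=
  fun _ hx => (le_of_absMonotone_of_mem_absCone hF hv0 hx).trans hB

/-- **`sup_{absCone v} I_{p,l} = I_{p,l}(v)`** (`p ≥ 1`, `d ≥ 2p+1`, `v ≥ 0`), read form.
[cite: FitznerVanDerHofstad2016NoBLE, Lemma 5.1 p. 1093; §5.1] -/
theorem srwI_le_on_absCone {p : ℕ} (hp : 1 ≤ p) (hd : 2 * p + 1 ≤ d) (l : ℕ) {v : Fin d → ℤ} (hv0 : ∀ j, 0 ≤ v j)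
    {B : ℝ} (hB : srwI d p l v ≤ B) : ∀ x ∈ absCone v, srwI d p l x ≤ B :=
  le_on_absCone_of_absMonotone (absMonotone_srwI hp hd l) hv0 hB

/-- The CONE MAJORANT of a shift sum: `S^♯_F(v) = Σ_j (F(v + 2e_j) + F(v − min(v_j,2) e_j))` — in direction `j` the outward shift is
read at `v + 2e_j` and the inward one at `v` with `v_j` lowered to `max(v_j − 2, 0)`.
[cite: FitznerVanDerHofstad2016NoBLE, Lemma 5.1 p. 1093; (3.30) p. 1070] -/
def shift2Cone (F : (Fin d → ℤ) → ℝ) (v : Fin d → ℤ) : ℝ :=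
  ∑ j : Fin d, (F (v + axisVec j 2) + F (v - axisVec j (min (v j) 2)))

/-- **`S_F ≤ S^♯_F(v)` on `absCone v`** for coordinatewise-monotone `F` and `v ≥ 0`: for `x` in the cone and each direction `j`,
the shift of `x` away from `0` dominates `v + 2e_j` in absolute value and the shift towards `0` dominates `v − min(v_j,2)e_j`.
[cite: FitznerVanDerHofstad2016NoBLE, Lemma 5.1 p. 1093; (3.30) p. 1070] -/
theorem shift2Sum_le_shift2Cone {F : (Fin d → ℤ) → ℝ} (hF : AbsMonotone F) {v x : Fin d → ℤ} (hv0 : ∀ j, 0 ≤ v j)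
    (hx : x ∈ absCone v) : shift2Sum F x ≤ shift2Cone F v := by
  unfold shift2Sum shift2Cone
  refine Finset.sum_le_sum fun ι _ => ?_
  have hvι := hv0 ι
  have hxι := hx ι
  -- the two comparison patterns, coordinate `μ ≠ ι` being common
  have hoff : ∀ (s t : ℤ) (μ : Fin d), μ ≠ ι → |(v + axisVec ι t) μ| ≤ |(x + axisVec ι s) μ| := by
    intro s t μ hμ
    rw [add_axisVec_apply_of_ne x hμ, add_axisVec_apply_of_ne v hμ, abs_of_nonneg (hv0 μ)]
    exact hx μ
  have hout : ∀ s : ℤ, |x ι| + 2 = |x ι + s| → F (x + axisVec ι s) ≤ F (v + axisVec ι 2) := by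
    intro s hs
    refine hF _ _ fun μ => ?_
    by_cases hμ : μ = ι
    · subst hμ
      rw [add_axisVec_apply_self, add_axisVec_apply_self, ← hs, abs_of_nonneg (by omega)]
      omega
    · exact hoff s 2 μ hμ
  have hin : ∀ s : ℤ, |x ι| - 2 ≤ |x ι + s| → F (x + axisVec ι s) ≤ F (v - axisVec ι (min (v ι) 2)) := by
    intro s hs
    rw [sub_axisVec_eq_add]
    refine hF _ _ fun μ => ?_
    by_cases hμ : μ = ι
    · subst hμ
      rw [add_axisVec_apply_self, add_axisVec_apply_self, abs_of_nonneg (by omega)]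
      have h0 : 0 ≤ |x μ + s| := abs_nonneg _
      omega
    · exact hoff s _ μ hμ
  rw [sub_axisVec_eq_add x]
  rcases le_or_gt 0 (x ι) with hx0 | hx0
  · -- outward `+2`, inward `−2`
    have habs : |x ι| = x ι := abs_of_nonneg hx0
    refine add_le_add (hout 2 ?_) (hin (-2) ?_)
    · rw [habs, abs_of_nonneg (by omega)]
    · rw [habs]
      exact le_abs.2 (Or.inl (by omega))
  · -- outward `−2`, inward `+2`
    have habs : |x ι| = -x ι := abs_of_neg hx0
    rw [add_comm (F (v + axisVec ι 2))]
    refine add_le_add (hin 2 ?_) (hout (-2) ?_)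
    · rw [habs]
      exact le_abs.2 (Or.inr (by omega))
    · rw [habs, abs_of_neg (by omega)]; ring

/-- **`S_{p,l} ≤ S^♯_{I_{p,l}}(v)` on `absCone v`** (`p ≥ 1`, `d ≥ 2p+1`, `v ≥ 0`).
[cite: FitznerVanDerHofstad2016NoBLE, Lemma 5.1 p. 1093; (3.30) p. 1070] -/
theorem srwIShift2_le_shift2Cone {p : ℕ} (hp : 1 ≤ p) (hd : 2 * p + 1 ≤ d) (l : ℕ) {v x : Fin d → ℤ}
    (hv0 : ∀ j, 0 ≤ v j) (hx : x ∈ absCone v) : srwIShift2 d p l x ≤ shift2Cone (srwI d p l) v := by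
  rw [srwIShift2_eq_shift2Sum]
  exact shift2Sum_le_shift2Cone (absMonotone_srwI hp hd l) hv0 hx

/-- Read form: `S_{p,l} ≤ B` on `absCone v` from `S^♯_{I_{p,l}}(v) ≤ B`. [cite: FitznerVanDerHofstad2016NoBLE, Lemma 5.1 p. 1093; (3.30) p. 1070] -/
theorem srwIShift2_le_on_absCone {p : ℕ} (hp : 1 ≤ p) (hd : 2 * p + 1 ≤ d) (l : ℕ) {v : Fin d → ℤ} (hv0 : ∀ j, 0 ≤ v j)
    {B : ℝ} (hB : shift2Cone (srwI d p l) v ≤ B) : ∀ x ∈ absCone v, srwIShift2 d p l x ≤ B :=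
  fun _ hx => (srwIShift2_le_shift2Cone hp hd l hv0 hx).trans hB


/-- Read form with the `(ᾱ − 1)` weight of the `IM` rows `m ≥ 0`. [cite: FitznerVanDerHofstad2016NoBLE, §3.3.5 (3.87) p. 1079; Lemma 5.1 p. 1093] -/
theorem mul_srwIShift2_le_on_absCone {p : ℕ} (hp : 1 ≤ p) (hd : 2 * p + 1 ≤ d) (l : ℕ) {v : Fin d → ℤ}
    (hv0 : ∀ j, 0 ≤ v j) {afmax B t : ℝ} (hᾱ : 1 ≤ afmax) (hB : shift2Cone (srwI d p l) v ≤ B)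
    (hnum : (afmax - 1) * B ≤ t) : ∀ x ∈ absCone v, (afmax - 1) * srwIShift2 d p l x ≤ t :=
  fun x hx => (mul_le_mul_of_nonneg_left (srwIShift2_le_on_absCone hp hd l hv0 hB x hx) (by linarith)).trans hnum

/-- Read form of the first entry of the `IM(−1,l)` row, `I_{1,l+1} + S_{2,l}/(2d²α̲)`, on a cone (`d ≥ 5`).
[cite: FitznerVanDerHofstad2016NoBLE, §3.3.5 (3.87) p. 1079; Lemma 5.1 p. 1093] -/
theorem imNegOne_fst_le_on_absCone (hd : 5 ≤ d) (l : ℕ) {v : Fin d → ℤ} (hv0 : ∀ j, 0 ≤ v j) {afmin A₁ B t : ℝ}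
    (hα : 0 < afmin) (hA : srwI d 1 (l + 1) v ≤ A₁) (hB : shift2Cone (srwI d 2 l) v ≤ B)
    (hnum : A₁ + B / (2 * (d : ℝ) ^ 2 * afmin) ≤ t) :
    ∀ x ∈ absCone v, srwI d 1 (l + 1) x + srwIShift2 d 2 l x / (2 * (d : ℝ) ^ 2 * afmin) ≤ t := by
  intro x hx
  have hpos : 0 < 2 * (d : ℝ) ^ 2 * afmin := by
    have : (0 : ℝ) < d := by exact_mod_cast (show 0 < d by omega)
    positivity
  have h1 := srwI_le_on_absCone (p := 1) le_rfl (by omega) (l + 1) hv0 hA x hx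
  have h2 := srwIShift2_le_on_absCone (p := 2) (by norm_num) (by omega) l hv0 hB x hx
  exact (add_le_add h1 (div_le_div_of_nonneg_right h2 hpos.le)).trans hnum

/-! ### §3b  The cone majorant `S^♯_F` at the three nodes of `Q` -/

/-- Sum of a constant plus two different bumps over `Fin d`. [folklore] -/
private theorem sum_const_add_ite₂ (i j : Fin d) (b e₁ e₂ : ℝ) :
    ∑ ι : Fin d, (b + (if ι = i then e₁ else 0) + (if ι = j then e₂ else 0)) = d * b + e₁ + e₂ := by
  rw [Finset.sum_add_distrib, sum_const_add_ite, Finset.sum_ite_eq' Finset.univ j (fun _ => e₂),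
    if_pos (Finset.mem_univ _)]

/-- Sum of a constant plus three bumps over `Fin d`. [folklore] -/
private theorem sum_const_add_ite₃ (i j k : Fin d) (b e₁ e₂ e₃ : ℝ) :
    ∑ ι : Fin d, (b + (if ι = i then e₁ else 0) + (if ι = j then e₂ else 0) + (if ι = k then e₃ else 0)) =
      d * b + e₁ + e₂ + e₃ := by
  rw [Finset.sum_add_distrib, sum_const_add_ite₂, Finset.sum_ite_eq' Finset.univ k (fun _ => e₃),
    if_pos (Finset.mem_univ _)]

/-- Dropping a coordinate that vanishes in `w` can only increase a coordinatewise-monotone `F`. [folklore] -/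
private theorem le_of_absMonotone_add_axisVec {F : (Fin d → ℤ) → ℝ} (hF : AbsMonotone F) (w : Fin d → ℤ) {k : Fin d}
    (hk : w k = 0) (c : ℤ) : F (w + axisVec k c) ≤ F w :=
  hF _ _ fun μ => by
    by_cases hμ : μ = k
    · subst hμ
      rw [add_axisVec_apply_self, hk, zero_add, abs_zero]; exact abs_nonneg _
    · rw [add_axisVec_apply_of_ne w hμ]

/-- **`S^♯_F` at an axis point `a e_κ`, `a ≥ 2`** (`d ≥ 2`): `F((a+2)e_κ) + F((a−2)e_κ) + (d−1)(F(a e₁ + 2e₂) + F(a e_κ))`.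
[cite: FitznerVanDerHofstad2016NoBLE, Lemma 5.1 p. 1093; (3.30) p. 1070; (3.35) p. 1071] -/
theorem shift2Cone_axisVec {F : (Fin d → ℤ) → ℝ} (hI : SpInvariant F) (hd : 2 ≤ d) (κ : Fin d) {a : ℤ} (ha : 2 ≤ a) :
    shift2Cone F (axisVec κ a) = F (axisVec κ (a + 2)) + F (axisVec κ (a - 2))
      + ((d : ℝ) - 1) * (F (axisVec (⟨0, by omega⟩ : Fin d) a + axisVec (⟨1, by omega⟩ : Fin d) 2) + F (axisVec κ a)) := by
  set i₀ : Fin d := ⟨0, by omega⟩ with hi₀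
  set i₁ : Fin d := ⟨1, by omega⟩ with hi₁
  have h01 : i₀ ≠ i₁ := by simp [hi₀, hi₁, Fin.ext_iff]
  set g := F (axisVec i₀ a + axisVec i₁ 2) with hg
  have hoff : ∀ ι : Fin d, ι ≠ κ → F (axisVec κ a + axisVec ι 2) = g := by
    intro ι hικ
    rw [axisVec_add_axisVec_abs_eq_of_spInvariant hI (Ne.symm hικ) a 2, abs_of_nonneg (by omega : (0 : ℤ) ≤ a),
      show |(2 : ℤ)| = 2 by norm_num]
    exact axisVec_add_axisVec_eq_of_spInvariant hI (Ne.symm hικ) h01 a 2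
  have hterm : ∀ ι : Fin d, F (axisVec κ a + axisVec ι 2) + F (axisVec κ a - axisVec ι (min (axisVec κ a ι) 2)) =
      (g + F (axisVec κ a)) + (if ι = κ then F (axisVec κ (a + 2)) + F (axisVec κ (a - 2)) - (g + F (axisVec κ a)) else 0) := by
    intro ι
    by_cases hικ : ι = κ
    · rw [hικ, if_pos rfl, axisVec_apply', if_pos rfl, min_eq_right ha, sub_axisVec_eq_add, axisVec_add_axisVec_same,
        axisVec_add_axisVec_same, ← sub_eq_add_neg]
      ring
    · rw [if_neg hικ, add_zero, axisVec_apply', if_neg hικ, min_eq_left (by norm_num : (0 : ℤ) ≤ 2), axisVec_zero_right,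
        sub_zero, hoff ι hικ]
  unfold shift2Cone
  rw [Finset.sum_congr rfl fun ι _ => hterm ι, sum_const_add_ite]
  ring

/-- **`S^♯_F(3e₁) = F(5e₁) + F(e₁) + (d−1)(F(3e₁+2e₂) + F(3e₁))`** (`d ≥ 2`).
[cite: FitznerVanDerHofstad2016NoBLE, Lemma 5.1 p. 1093; (3.30) p. 1070; §5.1 p. 1093 (node `3e₁` of `Q`)] -/
theorem shift2Cone_vecOfParts_three {F : (Fin d → ℤ) → ℝ} (hI : SpInvariant F) (hd : 2 ≤ d) :
    shift2Cone F (vecOfParts d [3]) =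
      F (vecOfParts d [5]) + F (vecOfParts d [1]) + ((d : ℝ) - 1) * (F (vecOfParts d [3, 2]) + F (vecOfParts d [3])) := by
  rw [vecOfParts_single_eq_axisVec (by omega : 1 ≤ d) 3, vecOfParts_single_eq_axisVec (by omega : 1 ≤ d) 5,
    vecOfParts_single_eq_axisVec (by omega : 1 ≤ d) 1, vecOfParts_pair_eq_axisVec hd 3 2]
  push_cast
  rw [shift2Cone_axisVec hI hd _ (by norm_num : (2 : ℤ) ≤ 3), show (3 : ℤ) + 2 = 5 by norm_num,
    show (3 : ℤ) - 2 = 1 by norm_num]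

/-- Read form at `3e₁`: node values `F(5e₁) ≤ A`, `F(e₁) ≤ B`, `F(3e₁+2e₂) ≤ C`, `F(3e₁) ≤ D` give `S^♯_F(3e₁) ≤ A + B + (d−1)(C + D)`.
[cite: FitznerVanDerHofstad2016NoBLE, Lemma 5.1 p. 1093; (3.30) p. 1070; §5.1 p. 1093] -/
theorem shift2Cone_vecOfParts_three_le_of {F : (Fin d → ℤ) → ℝ} (hI : SpInvariant F) (hd : 2 ≤ d) {A B C D : ℝ}
    (h5 : F (vecOfParts d [5]) ≤ A) (h1 : F (vecOfParts d [1]) ≤ B) (h32 : F (vecOfParts d [3, 2]) ≤ C)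
    (h3 : F (vecOfParts d [3]) ≤ D) : shift2Cone F (vecOfParts d [3]) ≤ A + B + ((d : ℝ) - 1) * (C + D) := by
  rw [shift2Cone_vecOfParts_three hI hd]
  have hd' : (0 : ℝ) ≤ (d : ℝ) - 1 := by
    have : (2 : ℝ) ≤ d := by exact_mod_cast hd
    linarith
  exact add_le_add (add_le_add h5 h1) (mul_le_mul_of_nonneg_left (add_le_add h32 h3) hd')

/-- **`S^♯_F` at a two-axis point `a e_i + b e_j`** (`i ≠ j`, `a ≥ 2`, `0 ≤ b ≤ 2`, `d ≥ 3`): the two shifts along `i`, the outward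
shift along `j` and `F(a e_i)` (the inward one), and `d − 2` copies of `F(a e₁ + b e₂ + 2e₃) + F(a e_i + b e_j)`.
[cite: FitznerVanDerHofstad2016NoBLE, Lemma 5.1 p. 1093; (3.30) p. 1070; (3.35) p. 1071] -/
theorem shift2Cone_axisVec_add_axisVec {F : (Fin d → ℤ) → ℝ} (hI : SpInvariant F) (hd : 3 ≤ d) {i j : Fin d} (hij : i ≠ j)
    {a b : ℤ} (ha : 2 ≤ a) (hb0 : 0 ≤ b) (hb : b ≤ 2) :
    shift2Cone F (axisVec i a + axisVec j b) =
      F (axisVec i (a + 2) + axisVec j b) + F (axisVec i (a - 2) + axisVec j b)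
      + (F (axisVec i a + axisVec j (b + 2)) + F (axisVec i a))
      + ((d : ℝ) - 2) * (F (axisVec (⟨0, by omega⟩ : Fin d) a + axisVec (⟨1, by omega⟩ : Fin d) b
          + axisVec (⟨2, by omega⟩ : Fin d) 2) + F (axisVec i a + axisVec j b)) := by
  set i₀ : Fin d := ⟨0, by omega⟩ with hi₀
  set i₁ : Fin d := ⟨1, by omega⟩ with hi₁
  set i₂ : Fin d := ⟨2, by omega⟩ with hi₂
  have h01 : i₀ ≠ i₁ := by simp [hi₀, hi₁, Fin.ext_iff]
  have h02 : i₀ ≠ i₂ := by simp [hi₀, hi₂, Fin.ext_iff]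
  have h12 : i₁ ≠ i₂ := by simp [hi₁, hi₂, Fin.ext_iff]
  set v := axisVec i a + axisVec j b with hv
  set g := F (axisVec i₀ a + axisVec i₁ b + axisVec i₂ 2) with hg
  have hvi : v i = a := by rw [hv, Pi.add_apply, axisVec_apply', axisVec_apply', if_pos rfl, if_neg hij, add_zero]
  have hvj : v j = b := by rw [hv, Pi.add_apply, axisVec_apply', axisVec_apply', if_neg (Ne.symm hij), if_pos rfl, zero_add]
  have hvoff : ∀ ι : Fin d, ι ≠ i → ι ≠ j → v ι = 0 := fun ι hιi hιj => by
    rw [hv, Pi.add_apply, axisVec_apply', axisVec_apply', if_neg hιi, if_neg hιj, add_zero]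
  have hoff : ∀ ι : Fin d, ι ≠ i → ι ≠ j → F (v + axisVec ι 2) = g := by
    intro ι hιi hιj
    rw [hv, axisVec_add3_abs_eq_of_spInvariant hI hij (Ne.symm hιi) (Ne.symm hιj), abs_of_nonneg (by omega : (0 : ℤ) ≤ a),
      abs_of_nonneg hb0, show |(2 : ℤ)| = 2 by norm_num]
    exact axisVec_add3_eq_of_spInvariant hI hij (Ne.symm hιi) (Ne.symm hιj) h01 h02 h12 a b 2
  have hterm : ∀ ι : Fin d, F (v + axisVec ι 2) + F (v - axisVec ι (min (v ι) 2)) =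
      (g + F v) + (if ι = i then F (axisVec i (a + 2) + axisVec j b) + F (axisVec i (a - 2) + axisVec j b) - (g + F v) else 0)
        + (if ι = j then F (axisVec i a + axisVec j (b + 2)) + F (axisVec i a) - (g + F v) else 0) := by
    intro ι
    by_cases hιi : ι = i
    · rw [hιi, if_pos rfl, if_neg hij, add_zero, hvi, min_eq_right ha, hv, sub_axisVec_eq_add,
        add_right_comm _ (axisVec j b) (axisVec i 2), add_right_comm _ (axisVec j b) (axisVec i (-2)),
        axisVec_add_axisVec_same, axisVec_add_axisVec_same, ← sub_eq_add_neg]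
      ring
    · by_cases hιj : ι = j
      · rw [hιj, if_neg (Ne.symm hij), if_pos rfl, add_zero, hvj, min_eq_left hb, hv, sub_axisVec_eq_add,
          add_assoc _ (axisVec j b) (axisVec j 2), add_assoc _ (axisVec j b) (axisVec j (-b)), axisVec_add_axisVec_same,
          axisVec_add_axisVec_same, add_neg_cancel, axisVec_zero_right, add_zero]
        ring
      · rw [if_neg hιi, if_neg hιj, add_zero, add_zero, hvoff ι hιi hιj, min_eq_left (by norm_num : (0 : ℤ) ≤ 2),
          axisVec_zero_right, sub_zero, hoff ι hιi hιj]
  unfold shift2Cone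
  rw [Finset.sum_congr rfl fun ι _ => hterm ι, sum_const_add_ite₂]
  ring

/-- **`S^♯_F(2e₁+e₂) = F(4e₁+e₂) + F(e₁) + F(3e₁+2e₂) + F(2e₁) + (d−2)(F(2e₁+2e₂+e₃) + F(2e₁+e₂))`** (`d ≥ 3`).
[cite: FitznerVanDerHofstad2016NoBLE, Lemma 5.1 p. 1093; (3.30) p. 1070; §5.1 p. 1093 (node `2e₁+e₂` of `Q`)] -/
theorem shift2Cone_vecOfParts_two_one {F : (Fin d → ℤ) → ℝ} (hI : SpInvariant F) (hd : 3 ≤ d) :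
    shift2Cone F (vecOfParts d [2, 1]) =
      F (vecOfParts d [4, 1]) + F (vecOfParts d [1]) + (F (vecOfParts d [3, 2]) + F (vecOfParts d [2]))
      + ((d : ℝ) - 2) * (F (vecOfParts d [2, 2, 1]) + F (vecOfParts d [2, 1])) := by
  set i₀ : Fin d := ⟨0, by omega⟩ with hi₀
  set i₁ : Fin d := ⟨1, by omega⟩ with hi₁
  set i₂ : Fin d := ⟨2, by omega⟩ with hi₂
  have h01 : i₀ ≠ i₁ := by simp [hi₀, hi₁, Fin.ext_iff]
  have h02 : i₀ ≠ i₂ := by simp [hi₀, hi₂, Fin.ext_iff]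
  have h12 : i₁ ≠ i₂ := by simp [hi₁, hi₂, Fin.ext_iff]
  rw [vecOfParts_pair_eq_axisVec (by omega : 2 ≤ d) 2 1, vecOfParts_pair_eq_axisVec (by omega : 2 ≤ d) 4 1,
    vecOfParts_single_eq_axisVec (by omega : 1 ≤ d) 1, vecOfParts_pair_eq_axisVec (by omega : 2 ≤ d) 3 2,
    vecOfParts_single_eq_axisVec (by omega : 1 ≤ d) 2, vecOfParts_triple_eq_axisVec hd 2 2 1]
  push_cast
  rw [shift2Cone_axisVec_add_axisVec hI hd h01 (by norm_num : (2 : ℤ) ≤ 2) (by norm_num : (0 : ℤ) ≤ 1)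
      (by norm_num : (1 : ℤ) ≤ 2),
    show (2 : ℤ) + 2 = 4 by norm_num, show (2 : ℤ) - 2 = 0 by norm_num, show (1 : ℤ) + 2 = 3 by norm_num,
    axisVec_zero_right, zero_add]
  have hA : F (axisVec i₁ 1) = F (axisVec i₀ 1) := axisVec_eq_of_spInvariant hI i₁ i₀ 1
  have hB : F (axisVec i₀ 2 + axisVec i₁ 3) = F (axisVec i₀ 3 + axisVec i₁ 2) := by
    rw [axisVec_add_axisVec_eq_of_spInvariant hI h01 h01.symm 2 3, add_comm]
  have hC : F (axisVec i₀ 2 + axisVec i₁ 1 + axisVec i₂ 2) = F (axisVec i₀ 2 + axisVec i₁ 2 + axisVec i₂ 1) := by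
    rw [axisVec_add3_eq_of_spInvariant hI h01 h02 h12 h02 h01 h12.symm 2 1 2, add_right_comm]
  rw [hA, hB, hC]

/-- Read form at `2e₁+e₂`: node values at `4e₁+e₂`, `e₁`, `3e₁+2e₂`, `2e₁`, `2e₁+2e₂+e₃`, `2e₁+e₂` give
`S^♯_F(2e₁+e₂) ≤ A + B + (C + D) + (d−2)(E + G)`. [cite: FitznerVanDerHofstad2016NoBLE, Lemma 5.1 p. 1093; (3.30) p. 1070; §5.1 p. 1093] -/
theorem shift2Cone_vecOfParts_two_one_le_of {F : (Fin d → ℤ) → ℝ} (hI : SpInvariant F) (hd : 3 ≤ d) {A B C D E G : ℝ}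
    (h41 : F (vecOfParts d [4, 1]) ≤ A) (h1 : F (vecOfParts d [1]) ≤ B) (h32 : F (vecOfParts d [3, 2]) ≤ C)
    (h2 : F (vecOfParts d [2]) ≤ D) (h221 : F (vecOfParts d [2, 2, 1]) ≤ E) (h21 : F (vecOfParts d [2, 1]) ≤ G) :
    shift2Cone F (vecOfParts d [2, 1]) ≤ A + B + (C + D) + ((d : ℝ) - 2) * (E + G) := by
  rw [shift2Cone_vecOfParts_two_one hI hd]
  have hd' : (0 : ℝ) ≤ (d : ℝ) - 2 := by
    have : (3 : ℝ) ≤ d := by exact_mod_cast hd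
    linarith
  exact add_le_add (add_le_add (add_le_add h41 h1) (add_le_add h32 h2)) (mul_le_mul_of_nonneg_left (add_le_add h221 h21) hd')

/-- **`S^♯_F(e₁+e₂+e₃)`, upper read form** (`d ≥ 3`, `F` also coordinatewise monotone): the three support directions contribute
`F(3e₁+e₂+e₃) + F(e₁+e₂)` each; in the `d − 3` other directions the outward point `e₁+e₂+e₃+2e_ι` is relaxed to `2e₁+e₂+e₃`
(Lemma M, dropping one unit coordinate) and the inward point is the node itself:
`S^♯_F(e₁+e₂+e₃) ≤ 3(A + B) + (d−3)(C + D)`.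
[cite: FitznerVanDerHofstad2016NoBLE, Lemma 5.1 p. 1093; (3.30) p. 1070; §5.1 p. 1093 (node `e₁+e₂+e₃` of `Q`)] -/
theorem shift2Cone_classVec_three_le_of {F : (Fin d → ℤ) → ℝ} (hF : AbsMonotone F) (hI : SpInvariant F) (hd : 3 ≤ d)
    {A B C D : ℝ} (h311 : F (vecOfParts d [3, 1, 1]) ≤ A) (h11 : F (classVec d 2 0) ≤ B)
    (h211 : F (vecOfParts d [2, 1, 1]) ≤ C) (h111 : F (classVec d 3 0) ≤ D) :
    shift2Cone F (classVec d 3 0) ≤ 3 * (A + B) + ((d : ℝ) - 3) * (C + D) := by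
  set i₀ : Fin d := ⟨0, by omega⟩ with hi₀
  set i₁ : Fin d := ⟨1, by omega⟩ with hi₁
  set i₂ : Fin d := ⟨2, by omega⟩ with hi₂
  have h01 : i₀ ≠ i₁ := by simp [hi₀, hi₁, Fin.ext_iff]
  have h02 : i₀ ≠ i₂ := by simp [hi₀, hi₂, Fin.ext_iff]
  have h12 : i₁ ≠ i₂ := by simp [hi₁, hi₂, Fin.ext_iff]
  set v := classVec d 3 0 with hv
  have hv' : v = axisVec i₀ 1 + axisVec i₁ 1 + axisVec i₂ 1 := by
    rw [hv, classVec_three_zero_eq_vecOfParts, vecOfParts_triple_eq_axisVec hd 1 1 1]; push_cast; rfl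
  have h311' : F (axisVec i₀ 3 + axisVec i₁ 1 + axisVec i₂ 1) ≤ A := by
    have h := vecOfParts_triple_eq_axisVec hd 3 1 1
    push_cast at h
    rwa [h] at h311
  have h211' : F (axisVec i₀ 2 + axisVec i₁ 1 + axisVec i₂ 1) ≤ C := by
    have h := vecOfParts_triple_eq_axisVec hd 2 1 1
    push_cast at h
    rwa [h] at h211
  have h11' : ∀ {i j : Fin d}, i ≠ j → F (axisVec i 1 + axisVec j 1) ≤ B := fun {i j} hij => by
    rw [axisVec_add_axisVec_eq_of_spInvariant hI hij h01 1 1, ← classVec_two_zero_eq_axisVec (by omega : 2 ≤ d)]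
    exact h11
  -- coordinates of `v`
  have hvap : ∀ ι : Fin d, v ι = (if ι = i₀ then 1 else 0) + (if ι = i₁ then 1 else 0) + (if ι = i₂ then 1 else 0) := fun ι => by
    rw [hv', Pi.add_apply, Pi.add_apply, axisVec_apply', axisVec_apply', axisVec_apply']
  -- support directions
  have hsup₀ : F (v + axisVec i₀ 2) + F (v - axisVec i₀ (min (v i₀) 2)) ≤ A + B := by
    rw [hvap i₀, if_pos rfl, if_neg h01, if_neg h02, add_zero, add_zero, min_eq_left (by norm_num : (1 : ℤ) ≤ 2), hv',
      show axisVec i₀ 1 + axisVec i₁ 1 + axisVec i₂ 1 + axisVec i₀ (2 : ℤ) = axisVec i₀ 3 + axisVec i₁ 1 + axisVec i₂ 1 by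
        rw [show axisVec i₀ (3 : ℤ) = axisVec i₀ 1 + axisVec i₀ 2 by rw [axisVec_add_axisVec_same]; norm_num]; abel,
      show axisVec i₀ 1 + axisVec i₁ 1 + axisVec i₂ 1 - axisVec i₀ (1 : ℤ) = axisVec i₁ 1 + axisVec i₂ 1 by abel]
    exact add_le_add h311' (h11' h12)
  have hsup₁ : F (v + axisVec i₁ 2) + F (v - axisVec i₁ (min (v i₁) 2)) ≤ A + B := by
    rw [hvap i₁, if_neg h01.symm, if_pos rfl, if_neg h12, zero_add, add_zero, min_eq_left (by norm_num : (1 : ℤ) ≤ 2), hv',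
      show axisVec i₀ 1 + axisVec i₁ 1 + axisVec i₂ 1 + axisVec i₁ (2 : ℤ) = axisVec i₁ 3 + axisVec i₀ 1 + axisVec i₂ 1 by
        rw [show axisVec i₁ (3 : ℤ) = axisVec i₁ 1 + axisVec i₁ 2 by rw [axisVec_add_axisVec_same]; norm_num]; abel,
      show axisVec i₀ 1 + axisVec i₁ 1 + axisVec i₂ 1 - axisVec i₁ (1 : ℤ) = axisVec i₀ 1 + axisVec i₂ 1 by abel,
      axisVec_add3_eq_of_spInvariant hI h01.symm h12 h02 h01 h02 h12 3 1 1]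
    exact add_le_add h311' (h11' h02)
  have hsup₂ : F (v + axisVec i₂ 2) + F (v - axisVec i₂ (min (v i₂) 2)) ≤ A + B := by
    rw [hvap i₂, if_neg h02.symm, if_neg h12.symm, if_pos rfl, zero_add, zero_add, min_eq_left (by norm_num : (1 : ℤ) ≤ 2), hv',
      show axisVec i₀ 1 + axisVec i₁ 1 + axisVec i₂ 1 + axisVec i₂ (2 : ℤ) = axisVec i₂ 3 + axisVec i₀ 1 + axisVec i₁ 1 by
        rw [show axisVec i₂ (3 : ℤ) = axisVec i₂ 1 + axisVec i₂ 2 by rw [axisVec_add_axisVec_same]; norm_num]; abel,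
      show axisVec i₀ 1 + axisVec i₁ 1 + axisVec i₂ 1 - axisVec i₂ (1 : ℤ) = axisVec i₀ 1 + axisVec i₁ 1 by abel,
      axisVec_add3_eq_of_spInvariant hI h02.symm h12.symm h01 h01 h02 h12 3 1 1]
    exact add_le_add h311' (h11' h01)
  -- the other directions
  have hoff : ∀ ι : Fin d, ι ≠ i₀ → ι ≠ i₁ → ι ≠ i₂ →
      F (v + axisVec ι 2) + F (v - axisVec ι (min (v ι) 2)) ≤ C + D := by
    intro ι hι₀ hι₁ hι₂
    rw [hvap ι, if_neg hι₀, if_neg hι₁, if_neg hι₂, add_zero, add_zero, min_eq_left (by norm_num : (0 : ℤ) ≤ 2),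
      axisVec_zero_right, sub_zero]
    refine add_le_add ?_ h111
    have hw : v + axisVec ι 2 = (axisVec ι 2 + axisVec i₀ 1 + axisVec i₁ 1) + axisVec i₂ 1 := by rw [hv']; abel
    have hk : (axisVec ι 2 + axisVec i₀ 1 + axisVec i₁ 1) i₂ = 0 := by
      rw [Pi.add_apply, Pi.add_apply, axisVec_apply', axisVec_apply', axisVec_apply', if_neg (Ne.symm hι₂), if_neg h02.symm,
        if_neg h12.symm, add_zero, add_zero]
    rw [hw]
    refine (le_of_absMonotone_add_axisVec hF _ hk 1).trans ?_
    rw [axisVec_add3_eq_of_spInvariant hI hι₀ hι₁ h01 h01 h02 h12 2 1 1]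
    exact h211'
  have hterm : ∀ ι : Fin d, F (v + axisVec ι 2) + F (v - axisVec ι (min (v ι) 2)) ≤
      (C + D) + (if ι = i₀ then A + B - (C + D) else 0) + (if ι = i₁ then A + B - (C + D) else 0)
        + (if ι = i₂ then A + B - (C + D) else 0) := by
    intro ι
    by_cases h0 : ι = i₀
    · rw [h0, if_pos rfl, if_neg h01, if_neg h02]; linarith [hsup₀]
    · by_cases h1 : ι = i₁
      · rw [h1, if_neg h01.symm, if_pos rfl, if_neg h12]; linarith [hsup₁]
      · by_cases h2 : ι = i₂
        · rw [h2, if_neg h02.symm, if_neg h12.symm, if_pos rfl]; linarith [hsup₂]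
        · rw [if_neg h0, if_neg h1, if_neg h2]; linarith [hoff ι h0 h1 h2]
  unfold shift2Cone
  calc ∑ ι : Fin d, (F (v + axisVec ι 2) + F (v - axisVec ι (min (v ι) 2)))
      ≤ ∑ ι : Fin d, ((C + D) + (if ι = i₀ then A + B - (C + D) else 0) + (if ι = i₁ then A + B - (C + D) else 0)
          + (if ι = i₂ then A + B - (C + D) else 0)) := Finset.sum_le_sum fun ι _ => hterm ι
    _ = 3 * (A + B) + ((d : ℝ) - 3) * (C + D) := by rw [sum_const_add_ite₃]; ring

/-- **`S_{p,l}` on the cone of `e₁+e₂+e₃`, read form** (`p ≥ 1`, `d ≥ 2p+1`, `d ≥ 3`).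
[cite: FitznerVanDerHofstad2016NoBLE, Lemma 5.1 p. 1093; (3.30) p. 1070; §5.1 p. 1093] -/
theorem srwIShift2_le_on_absCone_one_one_one {p : ℕ} (hp : 1 ≤ p) (hd : 2 * p + 1 ≤ d) (hd3 : 3 ≤ d) (l : ℕ)
    {A B C D : ℝ} (h311 : srwI d p l (vecOfParts d [3, 1, 1]) ≤ A) (h11 : srwI d p l (classVec d 2 0) ≤ B)
    (h211 : srwI d p l (vecOfParts d [2, 1, 1]) ≤ C) (h111 : srwI d p l (classVec d 3 0) ≤ D) :
    ∀ x ∈ absCone (vecOfParts d [1, 1, 1]), srwIShift2 d p l x ≤ 3 * (A + B) + ((d : ℝ) - 3) * (C + D) := by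
  rw [← classVec_three_zero_eq_vecOfParts]
  exact srwIShift2_le_on_absCone hp hd l (fun j => by rw [classVec_three_zero_eq_vecOfParts]; exact vecOfParts_nonneg' _ j)
    (shift2Cone_classVec_three_le_of (absMonotone_srwI hp hd l) (spInvariant_srwI p l) hd3 h311 h11 h211 h111)

/-- **`S_{p,l}` on the cone of `3e₁`, read form** (`p ≥ 1`, `d ≥ 2p+1`).
[cite: FitznerVanDerHofstad2016NoBLE, Lemma 5.1 p. 1093; (3.30) p. 1070; §5.1 p. 1093] -/
theorem srwIShift2_le_on_absCone_three {p : ℕ} (hp : 1 ≤ p) (hd : 2 * p + 1 ≤ d) (l : ℕ) {A B C D : ℝ}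
    (h5 : srwI d p l (vecOfParts d [5]) ≤ A) (h1 : srwI d p l (vecOfParts d [1]) ≤ B)
    (h32 : srwI d p l (vecOfParts d [3, 2]) ≤ C) (h3 : srwI d p l (vecOfParts d [3]) ≤ D) :
    ∀ x ∈ absCone (vecOfParts d [3]), srwIShift2 d p l x ≤ A + B + ((d : ℝ) - 1) * (C + D) :=
  srwIShift2_le_on_absCone hp hd l (vecOfParts_nonneg' _)
    (shift2Cone_vecOfParts_three_le_of (spInvariant_srwI p l) (by omega) h5 h1 h32 h3)

/-- **`S_{p,l}` on the cone of `2e₁+e₂`, read form** (`p ≥ 1`, `d ≥ 2p+1`).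
[cite: FitznerVanDerHofstad2016NoBLE, Lemma 5.1 p. 1093; (3.30) p. 1070; §5.1 p. 1093] -/
theorem srwIShift2_le_on_absCone_two_one {p : ℕ} (hp : 1 ≤ p) (hd : 2 * p + 1 ≤ d) (l : ℕ) {A B C D E G : ℝ}
    (h41 : srwI d p l (vecOfParts d [4, 1]) ≤ A) (h1 : srwI d p l (vecOfParts d [1]) ≤ B)
    (h32 : srwI d p l (vecOfParts d [3, 2]) ≤ C) (h2 : srwI d p l (vecOfParts d [2]) ≤ D)
    (h221 : srwI d p l (vecOfParts d [2, 2, 1]) ≤ E) (h21 : srwI d p l (vecOfParts d [2, 1]) ≤ G) :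
    ∀ x ∈ absCone (vecOfParts d [2, 1]), srwIShift2 d p l x ≤ A + B + (C + D) + ((d : ℝ) - 2) * (E + G) :=
  srwIShift2_le_on_absCone hp hd l (vecOfParts_nonneg' _)
    (shift2Cone_vecOfParts_two_one_le_of (spInvariant_srwI p l) (by omega) h41 h1 h32 h2 h221 h21)

/-! ### §3c  The `𝒥` rule on a node cone -/

/-- `3e₁` is sorted. [cite: FitznerVanDerHofstad2016NoBLE, §5.1 p. 1093] -/
theorem antitone_vecOfParts_three : Antitone (vecOfParts d [3]) := by
  intro a b hab
  have h : (a : ℕ) ≤ b := hab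
  rw [vecOfParts_single_apply, vecOfParts_single_apply]
  split_ifs <;> omega

/-- `2e₁+e₂` is sorted. [cite: FitznerVanDerHofstad2016NoBLE, §5.1 p. 1093] -/
theorem antitone_vecOfParts_two_one : Antitone (vecOfParts d [2, 1]) := by
  intro a b hab
  have h : (a : ℕ) ≤ b := hab
  rw [vecOfParts_pair_apply, vecOfParts_pair_apply]
  split_ifs <;> push_cast <;> omega

/-- `e₁+e₂+e₃` is sorted. [cite: FitznerVanDerHofstad2016NoBLE, §5.1 p. 1093] -/
theorem antitone_vecOfParts_one_one_one : Antitone (vecOfParts d [1, 1, 1]) := by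
  intro a b hab
  have h : (a : ℕ) ≤ b := hab
  rw [vecOfParts_triple_apply, vecOfParts_triple_apply]
  split_ifs <;> push_cast <;> omega

/-- **Rule FIM-SUP on a node cone** (`s = 0` form of `srwJ_le_of_partsTables`): cone-filtered partition tables of `𝒥_{m-2,l}` up to
`ℓ¹`-radius `R` and of the cone majorant `B_{m-2,l}` on the frontier `R + 1` bound `𝒥_{m-2,l}` on all of `absCone v`.
[cite: FitznerVanDerHofstad2016NoBLE, Lemma 5.1 p. 1093; §5.1 p. 1093] [cite: FitznerVanDerHofstad2017, §2.5, notebook SRWIntegrals.nb / Percolation.nb (`BoundFThreeBound` node tables)] -/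
theorem srwJ_le_on_absCone_of_partsTables {m : ℕ} (hm : 1 ≤ m) (hd : 2 * (m + 1) + 1 ≤ d) (l R : ℕ) (M : ℝ)
    {v : Fin d → ℤ} (hv : Antitone v) (hv0 : ∀ j, 0 ≤ v j) (hvR : ∑ j, v j ≤ R + 1)
    (hInner : ∀ r : ℕ, r ≤ R → ∀ p ∈ partsLe r r r, (∀ j, v j ≤ vecOfParts d p j) → srwJ d m l (vecOfParts d p) ≤ M)
    (hFront : ∀ p ∈ partsLe (R + 1) (R + 1) (R + 1), (∀ j, v j ≤ vecOfParts d p j) →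
      srwJcone d m l (vecOfParts d p) ≤ M) :
    ∀ x ∈ absCone v, srwJ d m l x ≤ M :=
  fun x hx => srwJ_le_of_partsTables hm hd l 0 R M v hv hv0 hvR (fun r _ hr p hp hvp => hInner r hr p hp hvp) hFront x hx
    (by push_cast; exact Finset.sum_nonneg fun j _ => abs_nonneg (x j))

/-! ### §4  The per-cone reading of the `f₃` cell bounds on `Q` -/

namespace F3Bounds

variable {afmin afmax : ℝ}

/-- **Three cone bounds ⇒ the cell bound on all of `Q = {‖x‖₁ ≥ 3}`** (the shape of the hypotheses `h0Q`, `h1Q` of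
`nobleWeightedDiagramBoundAt_of_witness_srwTrue_smallX`): if the (3.87)-majorant at the true tables is `≤ b` on the upper cones of
`3e₁`, `2e₁+e₂` and `e₁+e₂+e₃`, it is `≤ b` at every `x` with `‖x‖₁ ≥ 3` (cone cover + `W_d`-invariance `boundHD75_srwTrue_spAct`).
[cite: FitznerVanDerHofstad2016NoBLE, §3.3.5 (3.87) p. 1079; §5.1 p. 1093] [cite: FitznerVanDerHofstad2017, §2.5, notebook Percolation.nb (`boundF3[2,o]`, `boundF3[3,o]`: `BoundFThreeBound[n,l,{{3},{1,1},{0,0,1}}]`)] -/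
theorem boundHD75_srwTrue_three_le_of_absCones (hd : 3 ≤ d) {n l : ℕ} {a : Args} {b : ℝ}
    (h3 : ∀ x ∈ absCone (vecOfParts d [3]), boundHD75 (srwTrue d afmin afmax) n l x a ≤ b)
    (h21 : ∀ x ∈ absCone (vecOfParts d [2, 1]), boundHD75 (srwTrue d afmin afmax) n l x a ≤ b)
    (h111 : ∀ x ∈ absCone (vecOfParts d [1, 1, 1]), boundHD75 (srwTrue d afmin afmax) n l x a ≤ b) :
    ∀ x : Fin d → ℤ, 3 ≤ ∑ j, |x j| → boundHD75 (srwTrue d afmin afmax) n l x a ≤ b :=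
  forall_three_le_of_absCones hd (P := fun x => boundHD75 (srwTrue d afmin afmax) n l x a ≤ b)
    (fun τ x h => by rwa [boundHD75_srwTrue_spAct] at h) h3 h21 h111

/-- The same as an equivalence: the cell bound on `Q` IS the conjunction of the three cone bounds.
[cite: FitznerVanDerHofstad2016NoBLE, §3.3.5 (3.87) p. 1079; §5.1 p. 1093] -/
theorem boundHD75_srwTrue_three_le_iff_absCones (hd : 3 ≤ d) {n l : ℕ} {a : Args} {b : ℝ} :
    (∀ x : Fin d → ℤ, 3 ≤ ∑ j, |x j| → boundHD75 (srwTrue d afmin afmax) n l x a ≤ b) ↔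
      (∀ x ∈ absCone (vecOfParts d [3]), boundHD75 (srwTrue d afmin afmax) n l x a ≤ b) ∧
        (∀ x ∈ absCone (vecOfParts d [2, 1]), boundHD75 (srwTrue d afmin afmax) n l x a ≤ b) ∧
          (∀ x ∈ absCone (vecOfParts d [1, 1, 1]), boundHD75 (srwTrue d afmin afmax) n l x a ≤ b) :=
  forall_three_le_iff_absCones hd (P := fun x => boundHD75 (srwTrue d afmin afmax) n l x a ≤ b)
    fun τ x h => by rwa [boundHD75_srwTrue_spAct] at h

/-- **Shell nodes + three cones ⇒ the cell bound on all of `𝒳 = {‖x‖₁ ≥ 2}`** (cells `(1,1)`, `(1,2)`, `(1,3)` in the per-cone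
reading). [cite: FitznerVanDerHofstad2016NoBLE, §3.3.5 (3.87) p. 1079; §5.1 p. 1093] [cite: FitznerVanDerHofstad2017, (2.21)–(2.23); §2.5, notebook Percolation.nb (`boundF3[4,o]`–`boundF3[6,o]`)] -/
theorem boundHD75_srwTrue_calX_le_of_nodes_of_absCones (hd : 3 ≤ d) {n l : ℕ} {a : Args} {b : ℝ}
    (h2 : boundHD75 (srwTrue d afmin afmax) n l (vecOfParts d [2]) a ≤ b)
    (h11 : boundHD75 (srwTrue d afmin afmax) n l (classVec d 2 0) a ≤ b)
    (h3 : ∀ x ∈ absCone (vecOfParts d [3]), boundHD75 (srwTrue d afmin afmax) n l x a ≤ b)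
    (h21 : ∀ x ∈ absCone (vecOfParts d [2, 1]), boundHD75 (srwTrue d afmin afmax) n l x a ≤ b)
    (h111 : ∀ x ∈ absCone (vecOfParts d [1, 1, 1]), boundHD75 (srwTrue d afmin afmax) n l x a ≤ b) :
    ∀ x ∈ calX d, boundHD75 (srwTrue d afmin afmax) n l x a ≤ b :=
  boundHD75_srwTrue_calX_le_of_nodes_of_Q (by omega) h2 h11 (boundHD75_srwTrue_three_le_of_absCones hd h3 h21 h111)

end F3Bounds

end Literature.Probability.FitznerVanDerHofstad2017

end
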